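import Summits.HodgeConjecture.HodgeConjecture.Theorems.K2LiuInertCartanIwasawaBlocks          -- ★ (K2Liu-p01): the field-generic Siegel blocks `kMat`, `dMat`, frames, `gramW_eq_smul_frame`
import Summits.HodgeConjecture.HodgeConjecture.Theorems.K2LiuDoublingSliceAtPlace              -- ★ (EV) (K2Liu-p05): `apply_eq_modDelta_mul_of_localDecomp`
import Summits.HodgeConjecture.HodgeConjecture.Theorems.K2LiuDoublingHeightSliceQuasiInvariance  -- ★ (K2Liu-p05): `exists_bound_and_inv_bound`
import Literature.NumberTheory.K2Lit.LocalDoublingSiegel                                         -- ★ D7a: `siegelDeltaLoc`, `isUnit_localDetDelta_of_mem_siegelDeltaLoc`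
import Literature.NumberTheory.Automorphic.HyperspecialUnitaryCompactOpen                       -- ★ `isCompact_unitaryInt_adicCompletion`
import Literature.NumberTheory.Automorphic.UnitaryGroupFormTransport                            -- ★ `unitaryGroupOfFormCongrOfEq`
import Literature.NumberTheory.Automorphic.LocalUnitaryGroupCongr

/-!
# HEIGHT DECAY along a Cartan ray in a RATIONAL hyperbolic frame, at ANY non-split place (organ (D) of (26-r): ramified ∕ dyadic ∕ non-unimodular alike)

Track B ∕ K2-LIT, hLiu418 = stmt-HodgeConjecture-24832; socket #32dR `sig_K2LiuDoublingHeightDecayLocalR2` (U5d ED. 5 :554) through ★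
`doublingHeightDecayLocalR2_of_nonsplitData` (K2Liu-p04 g3) and ★ (NS-i) `integrable_placeSlice_of_rankOneDecay`: the rank-one Cartan decay datum at an isotropic
non-split `v ∈ S` needs the DECAY `Φ(ι_v^H ι_v(t_m, 1)) ≤ C₂·r^m`.  LEAD F0P6-plan (g11) deal (26-r) → K2Liu-p04 (g4); REPORT-FIRST
`K2/K2Liu-p04/g4/REPORT-FIRST-26r-IsotropicAnyPlace.K2Liup04g4.md` (F3).

THE STATEMENT (`exists_decay_cartan_frame`).  Curve datum `(L, e : Fin 2 × Fin 1 ≃ Fin n, dV, dW)`; `v` a finite place of `L⁺` with `w ∣ v` fixed by `c`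
(inert OR ramified); `T ∈ GL₂(L_w)` ANY (rational, not necessarily integral) hyperbolic frame of the place form, `diag(dV)_w = σ_w(T)ᵀ·antidiag(1,1)·T`;
`Φ > 0` a continuous height of type `(P_Δ, modDelta)` on `H(𝔸)`.  THEN there is `C > 0` such that for every `σ_w`-FIXED `a ∈ 𝒪_w ∖ 0` and every `t ∈ G_v =
U(V)(L⁺_v)` with `t_w = T⁻¹·diag(a, a⁻¹)·T`:
  `Φ(ι_v^H(ι_v(t, 1))) ≤ C · √‖a‖_w`.
At an isotropic non-split place the `σ_w`-fixed `π = ϖ_w·σ_w(ϖ_w)` (`‖π‖_w = q_w⁻²`) gives the Cartan ray `c_i = T⁻¹·diag(π^i, π^{−i})·T` with decay `q_w^{−i}`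
(the even members of the ★ (F1) family `b_j = T⁻¹·diag(ϖ^j, (σϖ^j)⁻¹)·T` up to a unit central factor; the odd ones follow by quasi-invariance, (F4)).
THE PROOF = ★ #27i `K2LiuUnramifiedSectionOnCartanInert` (K2Liu-p01) WITHOUT INTEGRALITY OF `T`: the same explicit per-line Siegel blocks `κ₀ = [[a+1, −1], [1, 0]]`,
`κ₁ = [[0, 1], [−1, a+1]]` (they need only `σ_w a = a`, ★ `K2LiuInertCartanIwasawaBlocks`) give `ι_v(t,1) = p·k` with `p ∈ P_Δ(L⁺_v)`, `det_Δ p_w = a`, and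
`k = Ψ⁻¹(κ)` where `Ψ : H_v ≃ₜ* U(σ_w, dW₀·(J′ ⊕ −J′))` is the one-place model composed with the frame congruence (★ `localPiNonsplitEquiv`, ★
`unitaryGroupOfFormCongrOfEq`) and `κ ∈ K′₀ := U ∩ GL(𝒪_w)` — so `k` ranges in the FIXED COMPACT SET `Ψ⁻¹(K′₀)` (★ `isCompact_unitaryInt_adicCompletion`), on whose
image `Φ` is bounded (★ `exists_bound_and_inv_bound`); and `Φ(ι_v^H(p·k)) = modDelta(ι_v^H p)·Φ(ι_v^H k)` (★ (EV)) with `modDelta(ι_v^H p) = √‖det_Δ p_w‖_w = √‖a‖_w`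
(★ `modDelta_locToAdelic`, one place above `v`).  Theorems only; no `def`, no `sorry`.
[Li1992, §3 Thm. 3.1]; [GelbartPiatetskishapiroRallis1987, Part A §6]; [Liu2011, §2C (2-4) p. 863]; [Kudla1994, §3]; [HarrisKudlaSweet1996, §1 (1.9)–(1.15)].
HONEST LABEL: HC_CM is proved only modulo the 7 printed citations (2 remaining named inputs: hLiu418 = stmt-HodgeConjecture-24832, h413 =
stmt-HodgeConjecture-24833) until rung 0 closes; count-neutral helper toward #32dR (organ (26-r)), retires nothing by itself.
-/

set_option autoImplicit false
-- the mandated namespace repeats the single-problem summit's segment (`HodgeConjecture.HodgeConjecture`)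
set_option linter.dupNamespace false

noncomputable section

open scoped Matrix Kronecker
open NumberField IsDedekindDomain Matrix

namespace Summit.HodgeConjecture.HodgeConjecture.Cruxes.HLiu418.K2LiuCartanDecayFrame

open Literature.NumberTheory.Automorphic Literature.NumberTheory.Automorphic.UnitaryGroup Literature.NumberTheory.GaloisRepresentations
open Literature.NumberTheory.Automorphic.HermitianLattice
open Literature.NumberTheory.GelbartRogawski1991 Literature.NumberTheory.GelbartRogawski1991.GRConstruction
open Literature.NumberTheory.GelbartRogawski1991.UnitaryDualPair
open Literature.NumberTheory.K2Lit Literature.NumberTheory.K2Lit.SiegelDoubled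
open Summit.HodgeConjecture.HodgeConjecture.Cruxes.HLiu418.K2LiuSplitCartanIwasawa
open Summit.HodgeConjecture.HodgeConjecture.Cruxes.HLiu418.K2LiuUnramifiedSectionOnCartan
open Summit.HodgeConjecture.HodgeConjecture.Cruxes.HLiu418.K2LiuInertCartanIwasawaBlocks
open Summit.HodgeConjecture.HodgeConjecture.Cruxes.HLiu418.K2LiuDoublingSliceAtPlace
open Summit.HodgeConjecture.HodgeConjecture.Cruxes.HLiu418.K2LiuDoublingHeightSliceQuasiInvariance

variable (L : Type) [Field L] [NumberField L] [IsCMField L]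
variable {n : ℕ} (e : Fin 2 × Fin 1 ≃ Fin n)
  (dV : Fin 2 → L) (hdV : ∀ i, IsCMField.complexConj L (dV i) = dV i)
  (dW : Fin 1 → L) (hdW : ∀ i, IsCMField.complexConj L (dW i) = dW i)
  (v : HeightOneSpectrum (𝓞 (Fp L)))

set_option maxHeartbeats 400000 in -- as ★ #27i (`K2LiuUnramifiedSectionOnCartanInert`, measured 2026-09-04): the `p·k` telescope read through `localPiNonsplitEquiv` needs 400000
/-- **HEIGHT DECAY ALONG A CARTAN RAY IN A RATIONAL HYPERBOLIC FRAME, ANY NON-SPLIT PLACE.**  See the module docstring: for `w ∣ v` fixed by `c`, ANY frame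
`T ∈ GL₂(L_w)` of the place form and any continuous height `Φ > 0` of type `(P_Δ, modDelta)` there is `C > 0` with `Φ(ι_v^H(ι_v(t, 1))) ≤ C·√‖a‖_w` whenever
`t_w = T⁻¹·diag(a, a⁻¹)·T` with `a` `σ_w`-fixed, integral, non-zero.
[cite: Li1992, §3 Thm. 3.1] [cite: GelbartPiatetskishapiroRallis1987, Part A §6] [cite: Liu2011, §2C p. 863] [cite: Kudla1994, §3] -/
theorem exists_decay_cartan_frame (w : UnitaryGroup.PlacesOver L v) (hw : IsCMField.complexConj L • w.1 = w.1)
    (T : GL (Fin 2) (w.1.adicCompletion L))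
    (hTJ : UnitaryGroup.placeForm (Matrix.diagonal dV) w.1 =
      formCongr (galAdicCompletionMap (L := L) (IsCMField.complexConj L) hw) T ((StdForm.antidiagonal 2).over (w.1.adicCompletion L)))
    {Φ : HA L e dV hdV dW hdW → ℝ} (hΦc : Continuous Φ) (hΦpos : ∀ x, 0 < Φ x)
    (hΦ : ∀ p x : HA L e dV hdV dW hdW, IsSiegelDelta L e dV hdV dW hdW p →
      Φ (p * x) = modDelta L e dV hdV dW hdW p * Φ x) :
    ∃ C : ℝ, 0 < C ∧ ∀ (a : w.1.adicCompletion L), galAdicCompletionMap (L := L) (IsCMField.complexConj L) hw a = a →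
      Valued.v a ≤ 1 → a ≠ 0 →
      ∀ t : UnitaryGroup.localPi L (IsCMField.complexConj L) 2 (Matrix.diagonal dV) v,
        Units.val ((t : UnitaryGroup.LocalGLPi L 2 v) w) =
          ((T⁻¹ : GL (Fin 2) (w.1.adicCompletion L)) : Matrix (Fin 2) (Fin 2) (w.1.adicCompletion L)) *
            Matrix.diagonal ![a, a⁻¹] * (T : Matrix (Fin 2) (Fin 2) (w.1.adicCompletion L)) →
        Φ (locToAdelic L e dV hdV dW hdW v (iotaLeftLocPi L e dV hdV dW hdW v t)) ≤ C * Real.sqrt ‖a‖ := by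
  classical
  haveI : Algebra.IsQuadraticExtension (Fp L) L := IsCMField.isQuadraticExtension L
  have hc : IsCMField.complexConj L ≠ 1 := IsCMField.complexConj_ne_one L
  -- shorthand: the conjugation `σ` of `L_w`, the line enumeration `eL`
  set σ : w.1.adicCompletion L →+* w.1.adicCompletion L := galAdicCompletionMap (L := L) (IsCMField.complexConj L) hw with hσ
  set eL : Fin n ≃ Fin 2 := e.symm.trans (Equiv.prodUnique (Fin 2) (Fin 1)) with heL
  -- the frame blocks `T' = T`, `T'⁻¹` enumerated along the lines, and the frames `Tb = T' ⊕ T'`, `Tbi = T'⁻¹ ⊕ T'⁻¹`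
  set T' : Matrix (Fin n) (Fin n) (w.1.adicCompletion L) := (T : Matrix (Fin 2) (Fin 2) (w.1.adicCompletion L)).submatrix eL eL with hT'
  set Ti : Matrix (Fin n) (Fin n) (w.1.adicCompletion L) := ((T⁻¹ : GL (Fin 2) (w.1.adicCompletion L)) : Matrix (Fin 2) (Fin 2) (w.1.adicCompletion L)).submatrix eL eL with hTi'
  have hTT : T' * Ti = 1 := by
    rw [hT', hTi', Matrix.submatrix_mul_equiv, ← Units.val_mul, mul_inv_cancel, Units.val_one, Matrix.submatrix_one_equiv]
  have hTT' : Ti * T' = 1 := by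
    rw [hT', hTi', Matrix.submatrix_mul_equiv, ← Units.val_mul, inv_mul_cancel, Units.val_one, Matrix.submatrix_one_equiv]
  set Tb : Matrix (Fin (n + n)) (Fin (n + n)) (w.1.adicCompletion L) := Matrix.reindex (LocalSplitting.e₂ n) (LocalSplitting.e₂ n) (Matrix.fromBlocks T' 0 0 T') with hTb
  set Tbi : Matrix (Fin (n + n)) (Fin (n + n)) (w.1.adicCompletion L) := Matrix.reindex (LocalSplitting.e₂ n) (LocalSplitting.e₂ n) (Matrix.fromBlocks Ti 0 0 Ti)
    with hTbi
  have hTb1 : ∀ X : Matrix (Fin (n + n)) (Fin (n + n)) (w.1.adicCompletion L), Tb * (Tbi * X) = X := fun X => by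
    rw [← Matrix.mul_assoc, hTb, hTbi, frame_mul_frame, hTT, reindex_fromBlocks_one_one, Matrix.one_mul]
  have hTb2 : ∀ X : Matrix (Fin (n + n)) (Fin (n + n)) (w.1.adicCompletion L), Tbi * (Tb * X) = X := fun X => by
    rw [← Matrix.mul_assoc, hTb, hTbi, frame_mul_frame, hTT', reindex_fromBlocks_one_one, Matrix.one_mul]
  have hTbTbi : Tb * Tbi = 1 := by simpa only [Matrix.mul_one] using hTb1 1
  have hTbiTb : Tbi * Tb = 1 := by simpa only [Matrix.mul_one] using hTb2 1
  -- the form `J' ⊕ −J'` in the frame and the doubled place form: `J^𝔻_w = dW₀ · (σ Tb)ᵀ (J' ⊕ −J') Tb = ᵗσ(Tb) · J″ · Tb`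
  set Jm : Matrix (Fin (n + n)) (Fin (n + n)) (w.1.adicCompletion L) := Matrix.reindex (LocalSplitting.e₂ n) (LocalSplitting.e₂ n)
    (Matrix.fromBlocks (((StdForm.antidiagonal 2).over (w.1.adicCompletion L)).submatrix eL eL) 0 0 (-((StdForm.antidiagonal 2).over (w.1.adicCompletion L)).submatrix eL eL)) with hJm
  have hPF : UnitaryGroup.placeForm (hermD L e dV hdV dW hdW) w.1 = algebraMap L (w.1.adicCompletion L) (dW 0) • ((Tb.map σ)ᵀ * Jm * Tb) := by
    have hblk : ∀ (c : w.1.adicCompletion L) (X : Matrix (Fin n) (Fin n) (w.1.adicCompletion L)),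
        Matrix.fromBlocks (c • X) 0 0 (-(c • X)) = c • Matrix.fromBlocks X 0 0 (-X) := by
      intro c X; rw [Matrix.fromBlocks_smul, smul_zero, smul_neg]
    rw [hTb, hJm, frame_transpose_mul_form_mul_frame, LocalSplitting.placeForm_eq (Fp L) L v n (hermD_eq_map_gramD L e dV hdV dW hdW) w,
      gramW_eq_smul_frame L e dV hdV dW hdW v w hw T hTJ, ← hσ, ← heL, ← hT', hblk, Matrix.reindex_apply, Matrix.reindex_apply,
      Matrix.submatrix_smul, Pi.smul_apply, Pi.smul_apply]
  let TbGL : GL (Fin (n + n)) (w.1.adicCompletion L) := ⟨Tb, Tbi, hTbTbi, hTbiTb⟩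
  set J'' : Matrix (Fin (n + n)) (Fin (n + n)) (w.1.adicCompletion L) := algebraMap L (w.1.adicCompletion L) (dW 0) • Jm with hJ''
  have hform : formCongr σ TbGL J'' = UnitaryGroup.placeForm (hermD L e dV hdV dW hdW) w.1 := by
    rw [hPF, hJ'']
    change ((Tb.map σ)ᵀ * (algebraMap L (w.1.adicCompletion L) (dW 0) • Jm)) * Tb = _
    rw [Matrix.mul_smul, Matrix.smul_mul]
  -- `Ψ : H_v ≃ₜ* U(σ, J″)`, `k ↦ Tb k_w Tb⁻¹`, and the compact set `Ψ⁻¹(K′₀)`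
  let Ψ : UnitaryGroup.localPi L (IsCMField.complexConj L) (n + n) (hermD L e dV hdV dW hdW) v ≃ₜ* unitaryGroupOfForm σ J'' :=
    (localPiNonsplitEquiv (IsCMField.complexConj L) (hermD L e dV hdV dW hdW) hc w hw).trans
      (unitaryGroupOfFormCongrOfEq σ TbGL J'' _ hform)
  have hΨ : ∀ u, ((Ψ u : unitaryGroupOfForm σ J'') : GL (Fin (n + n)) (w.1.adicCompletion L)) =
      TbGL * (u : UnitaryGroup.LocalGLPi L (n + n) v) w * TbGL⁻¹ := fun u => rfl
  have hCc : IsCompact (locToAdelic L e dV hdV dW hdW v '' (Ψ.symm '' (unitaryInt σ J'' : Set (unitaryGroupOfForm σ J'')))) :=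
    ((isCompact_unitaryInt_adicCompletion (IsCMField.complexConj L) v w hw J'').image Ψ.symm.continuous).image
      (UnitaryGroup.continuous_inclPlaceAdelic (Fp L) L (IsCMField.complexConj L) (n + n) (hermD L e dV hdV dW hdW) v)
  obtain ⟨B, hB, hBK⟩ := exists_bound_and_inv_bound L e dV hdV dW hdW hΦc hΦpos hCc
  refine ⟨B, hB, fun a hσa hva ha t ht => ?_⟩
  -- NOW fix `a` and `t`; the matrices `k`, `k⁻¹` in the hyperbolic frame (★ #27i)
  have hva' : ValuativeRel.valuation (w.1.adicCompletion L) a ≤ 1 :=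
    ((ValuativeRel.isEquiv (ValuativeRel.valuation (w.1.adicCompletion L)) (Valued.v : Valuation (w.1.adicCompletion L) _)).le_one_iff_le_one).2 hva
  set Km : Matrix (Fin (n + n)) (Fin (n + n)) (w.1.adicCompletion L) := Matrix.reindex (LocalSplitting.e₂ n) (LocalSplitting.e₂ n)
    (Matrix.fromBlocks (diagonal fun j => ![a + 1, 0] (eL j)) (diagonal fun j => ![-1, 1] (eL j))
      (diagonal fun j => ![1, -1] (eL j)) (diagonal fun j => ![0, a + 1] (eL j))) with hKm
  set Lm : Matrix (Fin (n + n)) (Fin (n + n)) (w.1.adicCompletion L) := Matrix.reindex (LocalSplitting.e₂ n) (LocalSplitting.e₂ n)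
    (Matrix.fromBlocks (diagonal fun j => ![0, a + 1] (eL j)) (diagonal fun j => ![1, -1] (eL j))
      (diagonal fun j => ![-1, 1] (eL j)) (diagonal fun j => ![a + 1, 0] (eL j))) with hLm
  have hKL1 : ∀ X : Matrix (Fin (n + n)) (Fin (n + n)) (w.1.adicCompletion L), Km * (Lm * X) = X := fun X => by
    rw [← Matrix.mul_assoc, hKm, hLm, kMat_mul_lMat, Matrix.one_mul]
  have hLK : Lm * Km = 1 := mul_eq_one_comm.1 (by rw [hKm, hLm]; exact kMat_mul_lMat eL a)
  have hKLm : Km * Lm = 1 := by rw [hKm, hLm]; exact kMat_mul_lMat eL a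
  have hLK1 : ∀ X : Matrix (Fin (n + n)) (Fin (n + n)) (w.1.adicCompletion L), Lm * (Km * X) = X := fun X => by
    rw [← Matrix.mul_assoc, hLK, Matrix.one_mul]
  have hKu1 : ∀ X : Matrix (Fin (n + n)) (Fin (n + n)) (w.1.adicCompletion L), Kmᵀ * (Jm * (Km * X)) = Jm * X := fun X => by
    rw [← Matrix.mul_assoc, ← Matrix.mul_assoc, hKm, hJm, kMat_transpose_mul_form_mul_kMat]
  have hKσ : Km.map σ = Km := by
    have h1 : ∀ f : Fin 2 → (w.1.adicCompletion L), (∀ i, σ (f i) = f i) → (diagonal fun j => f (eL j)).map σ = diagonal fun j => f (eL j) := by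
      intro f hf
      rw [Matrix.diagonal_map (map_zero σ)]
      exact congrArg diagonal (funext fun j => hf (eL j))
    have hs : ∀ i : Fin 2, σ (![a + 1, 0] i) = ![a + 1, 0] i ∧ σ (![-1, 1] i) = ![-1, 1] i ∧ σ (![1, -1] i) = ![1, -1] i ∧
        σ (![0, a + 1] i) = ![0, a + 1] i := by
      intro i; fin_cases i <;> simp [hσa]
    rw [hKm, Matrix.reindex_apply, ← Matrix.submatrix_map, Matrix.fromBlocks_map, h1 _ fun i => (hs i).1, h1 _ fun i => (hs i).2.1,
      h1 _ fun i => (hs i).2.2.1, h1 _ fun i => (hs i).2.2.2]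
  -- the `GL` element `k_w = Tbi · Km · Tb`
  let Kgl : GL (Fin (n + n)) (w.1.adicCompletion L) :=
    ⟨Tbi * Km * Tb, Tbi * Lm * Tb, by simp only [Matrix.mul_assoc, hTb1, hKL1]; simpa only [Matrix.mul_one] using hTb2 1,
      by simp only [Matrix.mul_assoc, hTb1, hLK1]; simpa only [Matrix.mul_one] using hTb2 1⟩
  have hσT : ∀ X : Matrix (Fin (n + n)) (Fin (n + n)) (w.1.adicCompletion L), (Tbi.map σ)ᵀ * ((Tb.map σ)ᵀ * X) = X := fun X => by
    rw [← Matrix.mul_assoc, ← Matrix.transpose_mul, ← Matrix.map_mul, hTbTbi, Matrix.map_one σ (map_zero σ) (map_one σ), Matrix.transpose_one,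
      Matrix.one_mul]
  have hKU : Kgl ∈ unitaryGroupOfForm σ (UnitaryGroup.placeForm (hermD L e dV hdV dW hdW) w.1) := by
    rw [mem_unitaryGroupOfForm_iff]
    change ((Tbi * Km * Tb).map σ)ᵀ * UnitaryGroup.placeForm (hermD L e dV hdV dW hdW) w.1 * (Tbi * Km * Tb) = _
    rw [hPF, Matrix.map_mul, Matrix.map_mul, hKσ, Matrix.transpose_mul, Matrix.transpose_mul, Matrix.mul_smul, Matrix.smul_mul]
    simp only [Matrix.mul_assoc, hTb1, hσT, hKu1]
  -- the element `k ∈ H_v` through the one-place model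
  let k : UnitaryGroup.localPi L (IsCMField.complexConj L) (n + n) (hermD L e dV hdV dW hdW) v :=
    (localPiNonsplitEquiv (IsCMField.complexConj L) (hermD L e dV hdV dW hdW) hc w hw).symm ⟨Kgl, hKU⟩
  have hkw : (k : UnitaryGroup.LocalGLPi L (n + n) v) w = Kgl := by
    have h1 := coe_localPiNonsplitEquiv_apply (IsCMField.complexConj L) (hermD L e dV hdV dW hdW) hc w hw k
    rw [ContinuousMulEquiv.apply_symm_apply] at h1
    exact h1.symm
  have hKinv : ((Kgl⁻¹ : GL (Fin (n + n)) (w.1.adicCompletion L)) : Matrix (Fin (n + n)) (Fin (n + n)) (w.1.adicCompletion L)) = Tbi * Lm * Tb := rfl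
  -- `k` lies in the fixed compact set `Ψ⁻¹(K′₀)`: `Ψ k` has matrix `Km`, inverse `Lm`, both integral
  have hvals : ∀ i : Fin 2, ValuativeRel.valuation (w.1.adicCompletion L) (![a + 1, 0] i) ≤ 1 ∧
      ValuativeRel.valuation (w.1.adicCompletion L) (![-1, 1] i) ≤ 1 ∧ ValuativeRel.valuation (w.1.adicCompletion L) (![1, -1] i) ≤ 1 ∧
      ValuativeRel.valuation (w.1.adicCompletion L) (![0, a + 1] i) ≤ 1 := by
    have hva1 : ValuativeRel.valuation (w.1.adicCompletion L) (a + 1) ≤ 1 := Valuation.map_add_le _ hva' (by rw [Valuation.map_one])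
    intro i; fin_cases i <;> simp [hva1]
  have vKm : ValBound 1 Km := valBound_reindex_fromBlocks_diagonal (Fp L) L v n w (fun j => (hvals (eL j)).1) (fun j => (hvals (eL j)).2.1)
    (fun j => (hvals (eL j)).2.2.1) (fun j => (hvals (eL j)).2.2.2)
  have vLm : ValBound 1 Lm := valBound_reindex_fromBlocks_diagonal (Fp L) L v n w (fun j => (hvals (eL j)).2.2.2) (fun j => (hvals (eL j)).2.2.1)
    (fun j => (hvals (eL j)).2.1) (fun j => (hvals (eL j)).1)
  have hΨk : Ψ k ∈ unitaryInt σ J'' := by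
    have hv1 : ((Ψ k : unitaryGroupOfForm σ J'') : GL (Fin (n + n)) (w.1.adicCompletion L)) = TbGL * Kgl * TbGL⁻¹ := by rw [hΨ, hkw]
    refine mem_unitaryInt_iff.2 ⟨fun i j => ?_, fun i j => ?_⟩
    · rw [hv1, Units.val_mul, Units.val_mul]
      change Valued.v ((Tb * (Tbi * Km * Tb) * Tbi) i j) ≤ 1
      rw [show Tb * (Tbi * Km * Tb) * Tbi = Km by simp only [Matrix.mul_assoc, hTb1, hTbTbi, Matrix.mul_one]]
      exact ((ValuativeRel.isEquiv (ValuativeRel.valuation (w.1.adicCompletion L)) (Valued.v : Valuation (w.1.adicCompletion L) _)).le_one_iff_le_one).1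
        (vKm i j)
    · rw [hv1, show (TbGL * Kgl * TbGL⁻¹)⁻¹ = TbGL * Kgl⁻¹ * TbGL⁻¹ by group, Units.val_mul, Units.val_mul, hKinv]
      change Valued.v ((Tb * (Tbi * Lm * Tb) * Tbi) i j) ≤ 1
      rw [show Tb * (Tbi * Lm * Tb) * Tbi = Lm by simp only [Matrix.mul_assoc, hTb1, hTbTbi, Matrix.mul_one]]
      exact ((ValuativeRel.isEquiv (ValuativeRel.valuation (w.1.adicCompletion L)) (Valued.v : Valuation (w.1.adicCompletion L) _)).le_one_iff_le_one).1
        (vLm i j)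
  have hkC : locToAdelic L e dV hdV dW hdW v k ∈ locToAdelic L e dV hdV dW hdW v '' (Ψ.symm '' (unitaryInt σ J'' : Set (unitaryGroupOfForm σ J''))) :=
    Set.mem_image_of_mem _ ⟨Ψ k, hΨk, Ψ.symm_apply_apply k⟩
  -- the `w`-component of `ι_v(t, 1)` in the frame: `Tbi · (diag(a ⊕ a⁻¹) ⊕ 1) · Tb`
  set Dm : Matrix (Fin (n + n)) (Fin (n + n)) (w.1.adicCompletion L) := Matrix.reindex (LocalSplitting.e₂ n) (LocalSplitting.e₂ n)
    (Matrix.fromBlocks (diagonal fun j => ![a, a⁻¹] (eL j)) 0 0 1) with hDm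
  have hblock : Ti * diagonal (fun j => ![a, a⁻¹] (eL j)) * T' =
      (((T⁻¹ : GL (Fin 2) (w.1.adicCompletion L)) : Matrix (Fin 2) (Fin 2) (w.1.adicCompletion L)) * Matrix.diagonal ![a, a⁻¹] *
        (T : Matrix (Fin 2) (Fin 2) (w.1.adicCompletion L))).submatrix eL eL := by
    have hD' : (Matrix.diagonal ![a, a⁻¹]).submatrix eL eL = diagonal fun j => ![a, a⁻¹] (eL j) := Matrix.submatrix_diagonal_equiv _ _
    rw [hTi', hT', ← hD', Matrix.submatrix_mul_equiv, Matrix.submatrix_mul_equiv]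
  have hh : Units.val (((iotaLeftLocPi L e dV hdV dW hdW v t :
        UnitaryGroup.localPi L (IsCMField.complexConj L) (n + n) (hermD L e dV hdV dW hdW) v) :
          UnitaryGroup.LocalGLPi L (n + n) v) w) = Tbi * Dm * Tb := by
    have h1 : Units.val (((1 : UnitaryGroup.localPi L (IsCMField.complexConj L) 2 (Matrix.diagonal dV) v) :
        UnitaryGroup.LocalGLPi L 2 v) w) = 1 := rfl
    have hre1 : Matrix.reindex e e (1 : Matrix (Fin 2 × Fin 1) (Fin 2 × Fin 1) (w.1.adicCompletion L)) = 1 := by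
      rw [Matrix.reindex_apply, Matrix.submatrix_one_equiv]
    rw [iotaLeftLocPi_apply, coe_iotaVLocPi_apply, ht, h1, Matrix.one_kronecker_one, reindex_kronecker_one_eq_submatrix e, ← heL, ← hblock, hre1,
      hTbi, hDm, hTb, frame_conj_blocks, Matrix.mul_zero, Matrix.zero_mul, Matrix.mul_one, hTT']
  -- `p := ι_v(t,1) · k⁻¹` and its `w`-component `Tbi · p̂ · Tb`
  set p : UnitaryGroup.localPi L (IsCMField.complexConj L) (n + n) (hermD L e dV hdV dW hdW) v := iotaLeftLocPi L e dV hdV dW hdW v t * k⁻¹ with hp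
  have hpk : iotaLeftLocPi L e dV hdV dW hdW v t = p * k := (inv_mul_cancel_right _ _).symm
  have hpw : Units.val (((p : UnitaryGroup.localPi L (IsCMField.complexConj L) (n + n) (hermD L e dV hdV dW hdW) v) :
      UnitaryGroup.LocalGLPi L (n + n) v) w) =
      Matrix.reindex (LocalSplitting.e₂ n) (LocalSplitting.e₂ n) (Matrix.fromBlocks
        (Ti * diagonal (fun j => ![a, a⁻¹] (eL j) * ![0, a + 1] (eL j)) * T') (Ti * diagonal (fun j => ![a, a⁻¹] (eL j) * ![1, -1] (eL j)) * T')
        (Ti * diagonal (fun j => ![-1, 1] (eL j)) * T') (Ti * diagonal (fun j => ![a + 1, 0] (eL j)) * T')) := by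
    rw [hp, Subgroup.coe_mul, Pi.mul_apply, Units.val_mul, Subgroup.coe_inv, Pi.inv_apply, hkw, hKinv, hh]
    have e1 : Tbi * Dm * Tb * (Tbi * Lm * Tb) = Tbi * (Dm * Lm) * Tb := by simp only [Matrix.mul_assoc, hTb1]
    rw [e1, hDm, hLm, dMat_mul_lMat, hTbi, hTb, frame_conj_blocks]
  -- `p ∈ P_Δ(L⁺_v)`
  have ha : a ≠ 0 := ha
  have hsum : diagonal (fun j => ![a, a⁻¹] (eL j) * ![0, a + 1] (eL j)) + diagonal (fun j => ![a, a⁻¹] (eL j) * ![1, -1] (eL j)) =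
      diagonal (fun j => ![-1, 1] (eL j)) + diagonal (fun j => ![a + 1, 0] (eL j)) := by
    rw [diagonal_add, diagonal_add]
    exact congrArg diagonal (funext fun j => siegel_line a ha (eL j))
  have hsum' : diagonal (fun j => ![a, a⁻¹] (eL j) * ![0, a + 1] (eL j)) + diagonal (fun j => ![a, a⁻¹] (eL j) * ![1, -1] (eL j)) =
      diagonal (fun j => ![a, 1] (eL j)) := by
    rw [diagonal_add]
    exact congrArg diagonal (funext fun j => detDelta_line a ha (eL j))
  have hp' : p ∈ siegelDeltaLoc L e dV hdV dW hdW v := by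
    rw [mem_siegelDeltaLoc_iff_isSiegelM]
    intro w'
    obtain rfl : w' = w := UnitaryGroup.PlacesOver.eq_of_smul_eq (IsCMField.complexConj L) hc w hw w'
    unfold IsSiegelM
    rw [hpw, ← Matrix.reindex_symm, Equiv.symm_apply_apply, Matrix.toBlocks_fromBlocks₁₁, Matrix.toBlocks_fromBlocks₁₂, Matrix.toBlocks_fromBlocks₂₁,
      Matrix.toBlocks_fromBlocks₂₂, ← Matrix.add_mul, ← Matrix.mul_add, ← Matrix.add_mul, ← Matrix.mul_add, hsum]
  -- `det_Δ p_w = a`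
  have hd₁ : LocalSplitting.detDelta (Fp L) L (IsCMField.complexConj L) v n w p = a := by
    simp only [LocalSplitting.detDelta, LocalSplitting.deltaBlock]
    rw [hpw, ← Matrix.reindex_symm, Equiv.symm_apply_apply, Matrix.toBlocks_fromBlocks₁₁, Matrix.toBlocks_fromBlocks₁₂, ← Matrix.add_mul,
      ← Matrix.mul_add, hsum', Matrix.det_mul, Matrix.det_mul, mul_right_comm, ← Matrix.det_mul, hTT', Matrix.det_one, one_mul, det_diagonal,
      Fintype.prod_equiv eL (fun j => ![a, 1] (eL j)) ![a, 1] (fun _ => rfl), Fin.prod_univ_two]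
    simp
  -- `modDelta(ι_v^H p) = √‖a‖` (one place above `v`)
  haveI : Subsingleton (UnitaryGroup.PlacesOver L v) := UnitaryGroup.PlacesOver.subsingleton_of_smul_eq (IsCMField.complexConj L) hc w hw
  have hmod : modDelta L e dV hdV dW hdW (locToAdelic L e dV hdV dW hdW v p) = Real.sqrt ‖a‖ := by
    rw [modDelta_locToAdelic L e dV hdV dW hdW v p (fun w' => isUnit_localDetDelta_of_mem_siegelDeltaLoc L e dV hdV dW hdW v hp' w'),
      Fintype.prod_subsingleton _ w]
    change Real.sqrt ‖LocalSplitting.detDelta (Fp L) L (IsCMField.complexConj L) v n w p‖ = _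
    rw [hd₁]
  -- conclude: `Φ(ι_v^H(p k)) = modDelta(ι_v^H p) · Φ(ι_v^H k) ≤ √‖a‖ · B`
  have hX : locToAdelic L e dV hdV dW hdW v (iotaLeftLocPi L e dV hdV dW hdW v t) =
      locToAdelic L e dV hdV dW hdW v p * locToAdelic L e dV hdV dW hdW v k := by rw [hpk, map_mul]
  rw [apply_eq_modDelta_mul_of_localDecomp L e dV hdV dW hdW v hΦ hp' hX, hmod, mul_comm]
  exact mul_le_mul_of_nonneg_right (hBK _ hkC).1 (Real.sqrt_nonneg _)

end Summit.HodgeConjecture.HodgeConjecture.Cruxes.HLiu418.K2LiuCartanDecayFrame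

end
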